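import Mathlib

/-!
# Extension complexity of the perfect matching polytope (Rothvoss 2017)

A NAMED FACT (unproved here): T. Rothvoss, *The matching polytope has exponential extension
complexity*, J. ACM 64 (2017), art. 41 (STOC 2014; arXiv:1311.2369), **Theorem 1**: for all even
`n`, the extension complexity of the perfect matching polytope `P_PM(K_n)` is `2^{Ω(n)}`.

The form stated here is the slack-matrix form. By Yannakakis' factorisation theorem (Yannakakis
1991; Theorem 4 of Rothvoss's paper) `xc(P_PM(K_n))` equals the non-negative rank of the slack
matrix of Edmonds' description `{x(δ(v)) = 1 (v ∈ V), x_e ≥ 0 (e ∈ E), x(δ(U)) ≥ 1 (|U| odd)}`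
against the vertices (= perfect matchings `M`). The degree rows of that slack matrix vanish and its
`C(n,2)` non-negativity rows `[e ∈ M]` have non-negative rank `≤ C(n,2)`, so Theorem 1 is equivalent
to: the ODD-CUT SLACK MATRIX `S_{U,M} = |M ∩ δ(U)| - 1` (rows: vertex sets `U` of odd size, columns:
perfect matchings `M` of `K_n`) has non-negative rank `≥ 2^{cn}` for some `c > 0` and all large
even `n` — which is also literally what the proof establishes (p. 5: "we consider the part of the
slack matrix that is induced by the odd set inequalities"; hyperplane-separation bound of §2 with
Lemma 6). As in `SeparationComplexity.hrubes_separation_rank_bound`, "`rk₊ ≤ r`" is unfolded into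
an explicit non-negative factorisation with `r` terms indexed by `Fin r`.

Design choices. Perfect matchings of `K_n` are the subgraphs `M` of `⊤ : SimpleGraph (Fin n)` with
`M.IsPerfectMatching` (Mathlib); `M ∩ δ(U)` is the set of edges of `M` of the form `s(x, y)` with
`x ∈ U`, `y ∉ U`, counted with `Set.ncard`; the row index runs over ALL `U : Finset (Fin n)` and the
column index over all subgraphs, the identity being required only for odd `U` and perfect matchings
`M` (the factor functions `a`, `b` are total). Consumer in the tree: the `q = 0` (LP) slice of the
stub `stub_unitPotentialHard` of crux `ConvexGateBlind` (route PneNP/ConvexRankGates), via the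
read-once monotone projection PERFECT-MATCHING ≤ CLIQUE.

## References

* T. Rothvoss, *The matching polytope has exponential extension complexity*, J. ACM 64(6) (2017)
  41:1–41:19, Theorem 1 and §2 [Rothvoss2017].
* M. Yannakakis, *Expressing combinatorial optimization problems by linear programs*, J. Comput.
  Syst. Sci. 43 (1991) 441–466, Theorem 3 [Yannakakis1991].
-/

namespace Literature.Computability.Complexity

/-- **Rothvoss's theorem, slack-matrix form** (Rothvoss 2017, Theorem 1, via Yannakakis 1991):
there is a constant `c > 0` such that for all sufficiently large EVEN `n` and every `r ≤ 2^{c·n}`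
there are no non-negative `a : (vertex sets) → ℝ^r` and `b : (subgraphs) → ℝ^r` with
`|M ∩ δ(U)| - 1 = ∑_{i<r} a_U(i) · b_M(i)` for every odd-size `U ⊆ Fin n` and every perfect
matching `M` of `K_n` — i.e. the odd-cut slack matrix `S_{U,M} = |M ∩ δ(U)| - 1` of the perfect
matching polytope has non-negative rank `> 2^{c·n}` (equivalently, by Yannakakis' factorisation
theorem and the `≤ C(n,2) + n` remaining rows of Edmonds' description, `xc(P_PM(K_n)) ≥ 2^{Ω(n)}`).
-- TODO(general form): the paper states `xc(P_PM(K_n)) ≥ 2^{Ω(n)}` for ALL even `n` (extension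
-- complexity); the slack form below absorbs the polynomially many non-odd-set rows into
-- "sufficiently large `n`" and the unspecified constant `c`.
[cite: Rothvoss2017, Thm. 1] -/
def rothvoss_matching_slack_bound : Prop :=
  ∃ c : ℝ, 0 < c ∧ ∀ᶠ n : ℕ in Filter.atTop, Even n → ∀ r : ℕ, (r : ℝ) ≤ 2 ^ (c * n) →
    ∀ (a : Finset (Fin n) → Fin r → ℝ) (b : (⊤ : SimpleGraph (Fin n)).Subgraph → Fin r → ℝ),
      (∀ U i, 0 ≤ a U i) → (∀ M i, 0 ≤ b M i) →
        ¬ ∀ (U : Finset (Fin n)) (M : (⊤ : SimpleGraph (Fin n)).Subgraph),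
            Odd U.card → M.IsPerfectMatching →
              ((M.edgeSet ∩ {e | ∃ x ∈ U, ∃ y ∉ U, e = s(x, y)}).ncard : ℝ) - 1 =
                ∑ i, a U i * b M i

end Literature.Computability.Complexity
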